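import Literature.NumberTheory.DiophantineGeometry.BelyiDegreeFourJ
import Literature.NumberTheory.DiophantineGeometry.FaltingsHeightJZero
import Literature.NumberTheory.DiophantineGeometry.FaltingsHeightJInvariantExplicit
import HarnessLib

/-!
# The converse for `j = 207646/6561`: an explicit degree-`4` Belyi function, and
# `deg_B(E) = 4 ↔ j(E) ∈ {1728, 207646/6561}`

Topic `NumberTheory/DiophantineGeometry`; sequel to `BelyiDegreeFourJ.lean` in the orbit of the
named fact `javanpeykar2014_stableFaltingsHeight_le`. [cite: Zapponi2009BelyiDegree, Example 1.2]
lists the two classes of elliptic curves of Belyi degree `4`: `j = 1728` (`BelyiDegreeThreeJZero`: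
`f = -x²/A` on `y² = x³ + Ax`) and `j = 207646/6561`. Here:

* **`IsBelyiFunction.of_card_eq`** — the converse of the Riemann–Hurwitz count
  `#U₀ + #U₁ + #U_∞ = d + 2 - 2g` (`IsBelyiFunction.card_add_card_add_card_eq`): a function whose
  fibres over `0, 1, ∞` already absorb all the ramification allowed by Riemann–Hurwitz is a Belyi
  function;
* the model `E₁ : y² = x³ + (13/16)x² + (9/32)x + 81/1024` (`j(E₁) = 207646/6561`) with the
  function `u = y - (x² + x/2 + 9/32)`: `u ū = x⁴` and   `(u + 27/64)(ū + 27/64) = (x - 9/8)(x +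
  3/8)³`, so `f = -(64/27) u` has the fibres `{(0, 9/32)}` over `0`, `{(9/8, ·), (-3/8, ·)}` over
  `1` and   `{O}` over `∞`; by `of_card_eq` it is a Belyi function of degree `4`
  (**`isBelyiFunction_E₁`**),   whence **`belyiDegree_eq_four_of_j_eq`** (`j = 207646/6561 ⇒ deg_B =
  4`, any model, by   `belyiDegree_eq_of_j_eq`) and the classification
  **`belyiDegree_eq_four_iff`**.

## References

* L. Zapponi, *On the Belyi degree(s) of a curve defined over a number field*, arXiv:0904.0967
  (2009), Example 1.2, §2.4. [Zapponi2009BelyiDegree]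
* H. Stichtenoth, *Algebraic Function Fields and Codes*, 2nd ed., GTM 254, Springer 2009,
  Cor. 3.5.5, Thm. 3.5.1. [Stichtenoth2009]
-/

noncomputable section

open scoped Classical IntermediateField Polynomial.Bivariate
open Polynomial WeierstrassCurve
open Literature.NumberTheory.EllipticCurves.WeierstrassFunctionField
open Literature.Computability.Cryptography.Csidh

universe u v

namespace Literature.NumberTheory.DiophantineGeometry

open AlgFunctionField BelyiDegreeThreeJZero BelyiDegreeFour BelyiDegreeFourJ

/-! ### The converse of the Riemann–Hurwitz count -/

namespace AlgFunctionField.IsBelyiFunction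

variable {K : Type u} {F : Type v} [Field K] [Field F] [Algebra K F]
variable [IsAlgFunctionField K F] [IsIntegrallyClosedIn K F] [CharZero K]

/-- **A function whose special fibres absorb all ramification is a Belyi function**: if all places
are rational and `#U₀ + #U₁ + #U_∞ = [F : K(y)] + 2 - 2g` for the fibres of `y ∉ K` over
`0, 1, ∞`, then `y` is unramified over every `c ≠ 0, 1` — in `2g - 2 = Σ_P diffOrd_P(y)`
([cite: Stichtenoth2009, Cor. 3.5.5]) the three fibres contribute `(d - #U₀) + (d - #U₁) +
(-d - #U_∞) = 2g - 2`, and every other contribution `diffOrd_P(y) = v_P(y - y(P)) - 1` is `≥ 0`,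
hence `0`. (Converse of `card_add_card_add_card_eq`.) [cite: Stichtenoth2009, Cor. 3.5.5] -/
theorem of_card_eq (hrat : ∀ P : PlaceOver K F, P.IsRational) {y : F}
    (hy : y ∉ Set.range (algebraMap K F)) (U₀ U₁ Ui : Finset (PlaceOver K F))
    (hU₀ : ∀ P, P ∈ U₀ ↔ 0 < P.ord y) (hU₁ : ∀ P, P ∈ U₁ ↔ 0 < P.ord (y - 1))
    (hUi : ∀ P, P ∈ Ui ↔ P.ord y < 0)
    (hcard : (U₀.card : ℤ) + U₁.card + Ui.card = Module.finrank K⟮y⟯ F + 2 - 2 * genus K F) :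
    IsBelyiFunction K y := by
  classical
  have hy0 : y ≠ 0 := fun h ↦ hy ⟨0, by rw [map_zero, h]⟩
  have hy1 : y - 1 ≠ 0 := fun h ↦ hy ⟨1, by rw [map_one]; exact (sub_eq_zero.1 h).symm⟩
  have ball0 : ∀ P ∈ U₀, y - algebraMap K F 0 ∈ P.ball 1 := fun P hP ↦ by
    rw [map_zero, sub_zero]
    exact (P.mem_ball_iff_le_ord 1 hy0).2 ((hU₀ P).1 hP)
  have ball1 : ∀ P ∈ U₁, y - algebraMap K F 1 ∈ P.ball 1 := fun P hP ↦ by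
    rw [map_one]
    exact (P.mem_ball_iff_le_ord 1 hy1).2 ((hU₁ P).1 hP)
  have h01 : Disjoint U₀ U₁ := Finset.disjoint_left.2 fun P hP0 hP1 ↦
    zero_ne_one (P.eq_of_sub_algebraMap_mem (ball0 P hP0) (ball1 P hP1))
  have hfin1 : ∀ P ∈ U₁, 0 ≤ P.ord y := fun P hP ↦ by
    have hmem : y - 1 ∈ P.toValuationSubring :=
      (P.mem_toValuationSubring_iff_ord_nonneg hy1).2 ((hU₁ P).1 hP).le
    have hyP : y ∈ P.toValuationSubring := by simpa using add_mem hmem (one_mem _)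
    exact (P.mem_toValuationSubring_iff_ord_nonneg hy0).1 hyP
  have h01i : Disjoint (U₀ ∪ U₁) Ui := Finset.disjoint_left.2 fun P hP hPi ↦ by
    have hi := (hUi P).1 hPi
    rcases Finset.mem_union.1 hP with h | h
    · have := (hU₀ P).1 h; omega
    · have := hfin1 P h; omega
  -- the three exact sums
  have e0 : ∑ P ∈ U₀, P.diffOrd y = (Module.finrank K⟮y⟯ F : ℤ) - U₀.card := by
    rw [← sum_ord_sub_eq_finrank hrat hy 0 U₀
        (fun P hP ↦ by rw [map_zero, sub_zero]; exact (hU₀ P).1 hP)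
        (fun P hP ↦ (hU₀ P).2 (by rwa [map_zero, sub_zero] at hP)),
      Finset.card_eq_sum_ones, Nat.cast_sum, Nat.cast_one, ← Finset.sum_sub_distrib]
    exact Finset.sum_congr rfl fun P hP ↦ P.diffOrd_of_sub_algebraMap_mem (ball0 P hP)
  have e1 : ∑ P ∈ U₁, P.diffOrd y = (Module.finrank K⟮y⟯ F : ℤ) - U₁.card := by
    rw [← sum_ord_sub_eq_finrank hrat hy 1 U₁
        (fun P hP ↦ by rw [map_one]; exact (hU₁ P).1 hP)
        (fun P hP ↦ (hU₁ P).2 (by rwa [map_one] at hP)),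
      Finset.card_eq_sum_ones, Nat.cast_sum, Nat.cast_one, ← Finset.sum_sub_distrib]
    exact Finset.sum_congr rfl fun P hP ↦ P.diffOrd_of_sub_algebraMap_mem (ball1 P hP)
  have ei : ∑ P ∈ Ui, P.diffOrd y = -(Module.finrank K⟮y⟯ F : ℤ) - Ui.card := by
    rw [← sum_neg_ord_eq_finrank hrat hy Ui (fun P hP ↦ (hUi P).1 hP) (fun P hP ↦ (hUi P).2 hP),
      Finset.card_eq_sum_ones, Nat.cast_sum, Nat.cast_one, ← Finset.sum_neg_distrib,
      ← Finset.sum_sub_distrib]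
    exact Finset.sum_congr rfl fun P hP ↦ by rw [P.diffOrd_of_ord_neg ((hUi P).1 hP)]; ring
  -- the support of `diffOrd`, and the remaining places
  set T : Finset (PlaceOver K F) := (differentialDivisor (dOf K y)).support with hT
  have hsuppT : Function.support (fun P : PlaceOver K F ↦ P.diffOrd y) ⊆ ↑T := by
    intro P hP
    rw [Function.mem_support] at hP
    rw [Finset.mem_coe, hT, Finsupp.mem_support_iff, differentialDivisor_dOf_apply hrat hy P]
    exact hP
  set S : Finset (PlaceOver K F) := (U₀ ∪ U₁ ∪ Ui) ∪ T with hS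
  have hsupp : Function.support (fun P : PlaceOver K F ↦ P.diffOrd y) ⊆ ↑S := by
    intro P hP
    have := hsuppT hP
    rw [Finset.mem_coe] at this ⊢
    exact Finset.mem_union_right _ this
  set Rest : Finset (PlaceOver K F) := S \ (U₀ ∪ U₁ ∪ Ui) with hRest
  have hSsplit : S = (U₀ ∪ U₁ ∪ Ui) ∪ Rest := by
    rw [hRest, Finset.union_sdiff_of_subset (Finset.subset_union_left)]
  have hdisj : Disjoint (U₀ ∪ U₁ ∪ Ui) Rest := by rw [hRest]; exact Finset.disjoint_sdiff
  have key := finsum_diffOrd_eq hrat hy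
  rw [finsum_eq_sum_of_support_subset _ hsupp, hSsplit, Finset.sum_union hdisj,
    Finset.sum_union h01i, Finset.sum_union h01, e0, e1, ei] at key
  have hrest : ∑ P ∈ Rest, P.diffOrd y = 0 := by linarith
  -- off the three fibres, `diffOrd ≥ 0`
  have hnonneg : ∀ P : PlaceOver K F, P ∉ Ui → 0 ≤ P.diffOrd y := by
    intro P hPi
    have hyP : y ∈ P.toValuationSubring :=
      (P.mem_toValuationSubring_iff_ord_nonneg hy0).2 (not_lt.1 fun h ↦ hPi ((hUi P).2 h))
    have hball : y - algebraMap K F (P.value y) ∈ P.ball 1 := (hrat P).sub_value_mem hyP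
    have hne : y - algebraMap K F (P.value y) ≠ 0 := fun e ↦ hy ⟨_, (sub_eq_zero.1 e).symm⟩
    have hord : 1 ≤ P.ord (y - algebraMap K F (P.value y)) := (P.mem_ball_iff_le_ord 1 hne).1 hball
    rw [P.diffOrd_of_sub_algebraMap_mem hball]; omega
  have hrest0 : ∀ P ∈ Rest, P.diffOrd y = 0 := by
    refine (Finset.sum_eq_zero_iff_of_nonneg fun P hP ↦ hnonneg P ?_).1 hrest
    rw [hRest, Finset.mem_sdiff] at hP
    exact fun h ↦ hP.2 (Finset.mem_union_right _ h)
  -- hence `diffOrd_P = 0` at every place off the three fibres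
  have hzero : ∀ P : PlaceOver K F, P ∉ U₀ → P ∉ U₁ → P ∉ Ui → P.diffOrd y = 0 := by
    intro P h0 h1 hi
    by_cases hPT : P ∈ T
    · exact hrest0 P (by
        rw [hRest, Finset.mem_sdiff, hS]
        refine ⟨Finset.mem_union_right _ hPT, fun h ↦ ?_⟩
        rcases Finset.mem_union.1 h with h | h
        · rcases Finset.mem_union.1 h with h | h
          · exact h0 h
          · exact h1 h
        · exact hi h)
    · rw [hT, Finsupp.mem_support_iff, not_not, differentialDivisor_dOf_apply hrat hy P] at hPT
      exact hPT
  -- the Belyi property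
  refine ⟨hy, fun c hc0 hc1 P hP ↦ ?_⟩
  have hne : y - algebraMap K F c ≠ 0 := fun e ↦ hy ⟨c, (sub_eq_zero.1 e).symm⟩
  have hball : y - algebraMap K F c ∈ P.ball 1 := (P.mem_ball_iff_le_ord 1 hne).2 hP
  have h0 : P ∉ U₀ := fun h ↦ hc0 (P.eq_of_sub_algebraMap_mem hball (ball0 P h))
  have h1 : P ∉ U₁ := fun h ↦ hc1 (P.eq_of_sub_algebraMap_mem hball (ball1 P h))
  have hi : P ∉ Ui := fun h ↦ by
    have hneg := (hUi P).1 h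
    have hyP : y ∈ P.toValuationSubring := by
      have h1 : y - algebraMap K F c ∈ P.toValuationSubring :=
        (P.mem_ball_zero_iff _).1 (P.ball_antitone (by norm_num) hball)
      simpa using add_mem h1 (P.algebraMap_mem c)
    have := (P.mem_toValuationSubring_iff_ord_nonneg hy0).1 hyP
    omega
  have h := hzero P h0 h1 hi
  rw [P.diffOrd_of_sub_algebraMap_mem hball] at h
  omega

end AlgFunctionField.IsBelyiFunction

/-! ### The model `E₁ : y² = x³ + (13/16)x² + (9/32)x + 81/1024` and `u = y - (x² + x/2 + 9/32)` -/

namespace BelyiDegreeFourConverse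

/-- The two norm identities of the model, evaluated: `L(α)² - g(α) = α⁴` and
`(L(α) - 27/64)² - g(α) = (α - 9/8)(α + 3/8)³` for `L = X² + X/2 + 9/32`,
`g = X³ + (13/16)X² + (9/32)X + 81/1024`. [cite: Zapponi2009BelyiDegree, §2.4] -/
theorem norm_identities {k : Type*} [Field k] [CharZero k] (α : k) :
    ((α ^ 2 + 1 / 2 * α + 9 / 32) ^ 2 - (α ^ 3 + 13 / 16 * α ^ 2 + 9 / 32 * α + 81 / 1024) =
      α ^ 4) ∧
      ((α ^ 2 + 1 / 2 * α + (9 / 32 - 27 / 64)) ^ 2 -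
        (α ^ 3 + 13 / 16 * α ^ 2 + 9 / 32 * α + 81 / 1024) = (α - 9 / 8) * (α + 3 / 8) ^ 3) := by
  constructor <;> ring

variable {K : Type u} [Field K] [CharZero K] {W : WeierstrassCurve K} [W.IsElliptic]

omit [CharZero K] [W.IsElliptic] in
/-- The coefficients of the model over `K̄`. [folklore] -/
theorem baseChange_coeffs (h₁ : W.a₁ = 0) (h₂ : W.a₂ = 13 / 16) (h₃ : W.a₃ = 0) (h₄ : W.a₄ = 9 / 32)
    (h₆ : W.a₆ = 81 / 1024) :
    (W.baseChange (AlgebraicClosure K)).a₁ = 0 ∧ (W.baseChange (AlgebraicClosure K)).a₂ = 13 / 16 ∧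
      (W.baseChange (AlgebraicClosure K)).a₃ = 0 ∧ (W.baseChange (AlgebraicClosure K)).a₄ = 9 / 32 ∧
      (W.baseChange (AlgebraicClosure K)).a₆ = 81 / 1024 := by
  refine ⟨?_, ?_, ?_, ?_, ?_⟩ <;>
    simp [WeierstrassCurve.baseChange, h₁, h₂, h₃, h₄, h₆, map_div₀, map_ofNat]

/-- **`u = y - L(x)` vanishes exactly where `y = L(x)` and `N_L(x) = 0`**: an affine zero
`(α, β)` of `y - L(x)` has `β = L(α)`, and then `N_L(α) = L(α)² - g(α) = 0` by the equation
(`a₁ = a₃ = 0`). [folklore] -/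
theorem value_of_zero (h₁ : W.a₁ = 0) (h₂ : W.a₂ = 13 / 16) (h₃ : W.a₃ = 0) (h₄ : W.a₄ = 9 / 32)
    (h₆ : W.a₆ = 81 / 1024) (L : (AlgebraicClosure K)[X]) {α β : AlgebraicClosure K}
    (h : (W.baseChange (AlgebraicClosure K)).toAffine.Nonsingular α β)
    (hpos : 0 < W.ordAt (.some α β h) (W.genY - aeval W.genX L)) :
    β = L.eval α ∧ (L.eval α) ^ 2 - (α ^ 3 + 13 / 16 * α ^ 2 + 9 / 32 * α + 81 / 1024) = 0 := by
  obtain ⟨b₁, b₂, b₃, b₄, b₆⟩ := baseChange_coeffs (W := W) h₁ h₂ h₃ h₄ h₆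
  have hu : W.genY - aeval W.genX L =
      algebraMap (W.baseChange (AlgebraicClosure K)).toAffine.CoordinateRing W.geomFunctionField
        (Affine.CoordinateRing.mk _ (Y - C L)) := by
    rw [EllipticCurves.WeierstrassFunctionField.algebraMap_mk]
    simp only [map_sub, aevalAeval_Y, aevalAeval_C]
  have hne : W.genY - aeval W.genX L ≠ 0 := by
    intro h0; rw [h0, ordAt_zero_right] at hpos; exact lt_irrefl _ hpos
  rw [WeierstrassCurve.ordAt, ← placeValuation_lt_one_iff_ord_pos _ hne, hu,
    placeValuation_some_algebraMap_lt_one_iff, pointEval_mk, evalEval_sub, evalEval_X,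
    evalEval_C, sub_eq_zero] at hpos
  refine ⟨hpos, ?_⟩
  have heq := (Affine.equation_iff _ _).1 h.1
  rw [b₁, b₂, b₃, b₄, b₆] at heq
  rw [← hpos]
  linear_combination heq

omit [CharZero K] in
/-- Conversely a point with `β = L(α)` is a zero of `y - L(x)`. [folklore] -/
theorem ordAt_pos_of_value (L : (AlgebraicClosure K)[X]) {α β : AlgebraicClosure K}
    (h : (W.baseChange (AlgebraicClosure K)).toAffine.Nonsingular α β) (hβ : β = L.eval α)
    (hne : W.genY - aeval W.genX L ≠ 0) :
    0 < W.ordAt (.some α β h) (W.genY - aeval W.genX L) := by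
  have hu : W.genY - aeval W.genX L =
      algebraMap (W.baseChange (AlgebraicClosure K)).toAffine.CoordinateRing W.geomFunctionField
        (Affine.CoordinateRing.mk _ (Y - C L)) := by
    rw [EllipticCurves.WeierstrassFunctionField.algebraMap_mk]
    simp only [map_sub, aevalAeval_Y, aevalAeval_C]
  rw [WeierstrassCurve.ordAt, ← placeValuation_lt_one_iff_ord_pos _ hne, hu,
    placeValuation_some_algebraMap_lt_one_iff, pointEval_mk, evalEval_sub, evalEval_X,
    evalEval_C, hβ, sub_self]

omit [CharZero K] in
/-- `y - L(x)` is regular at affine points. [folklore] -/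
theorem ordAt_sub_aeval_nonneg (L : (AlgebraicClosure K)[X]) {R : W.geomPoints} (hR : R ≠ 0) :
    0 ≤ W.ordAt R (W.genY - aeval W.genX L) := by
  have hu : W.genY - aeval W.genX L =
      algebraMap (W.baseChange (AlgebraicClosure K)).toAffine.CoordinateRing W.geomFunctionField
        (Affine.CoordinateRing.mk _ (Y - C L)) := by
    rw [EllipticCurves.WeierstrassFunctionField.algebraMap_mk]
    simp only [map_sub, aevalAeval_Y, aevalAeval_C]
  rw [hu]; exact ordAt_algebraMap_nonneg hR _

omit [CharZero K] in
/-- `v_O(a x + b) ≥ -2` (or `a x + b = 0`). [cite: SilvermanAEC2009, III.§1] -/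
theorem ordAt_zero_lin (a b : AlgebraicClosure K) :
    algebraMap _ W.geomFunctionField a * W.genX + algebraMap _ W.geomFunctionField b = 0 ∨
      -2 ≤ W.ordAt 0 (algebraMap _ W.geomFunctionField a * W.genX +
        algebraMap _ W.geomFunctionField b) := by
  have hx0 : W.genX ≠ 0 := fun h0 ↦ transcendental_genX W (h0 ▸ isAlgebraic_zero)
  rcases eq_or_ne a 0 with rfl | ha
  · rw [map_zero, zero_mul, zero_add]
    rcases eq_or_ne b 0 with rfl | hb
    · left; rw [map_zero]
    · right; rw [ordAt_algebraMap]; norm_num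
  · right
    have hax : W.ordAt 0 (algebraMap _ W.geomFunctionField a * W.genX) = -2 := by
      rw [ordAt_algebraMap_mul 0 ha, ordAt_zero_genX]
    rcases eq_or_ne b 0 with rfl | hb
    · rw [map_zero, add_zero, hax]
    · have hax0 : algebraMap _ W.geomFunctionField a * W.genX ≠ 0 :=
        mul_ne_zero ((_root_.map_ne_zero _).2 ha) hx0
      have hb0 : algebraMap (AlgebraicClosure K) W.geomFunctionField b ≠ 0 :=
        (_root_.map_ne_zero _).2 hb
      have hlt : (W.place 0).ord (algebraMap _ W.geomFunctionField a * W.genX) <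
          (W.place 0).ord (algebraMap (AlgebraicClosure K) W.geomFunctionField b) := by
        rw [← ordAt_eq_ord_place 0 hax0, hax, PlaceOver.ord_algebraMap_holds _ hb]; norm_num
      have h := (W.place 0).ord_add_eq_left_of_lt hax0 hb0 hlt
      rw [ordAt_eq_ord_place 0 h.1, h.2, ← ordAt_eq_ord_place 0 hax0, hax]

omit [CharZero K] in
/-- **`v_O(y - (x² + m₁x + m₀)) = -4`** (`v_O(x²) = -4 < -3 = v_O(y)`).
[cite: SilvermanAEC2009, III.§1] -/
theorem ordAt_zero_sub_quad (m₁ m₀ : AlgebraicClosure K) :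
    W.ordAt 0 (W.genY - aeval W.genX (X ^ 2 + C m₁ * X + C m₀)) = -4 := by
  have hx0 : W.genX ≠ 0 := fun h0 ↦ transcendental_genX W (h0 ▸ isAlgebraic_zero)
  have hy0 : W.genY ≠ 0 := genY_ne_zero
  have hx2ne : -(W.genX ^ 2) ≠ 0 := neg_ne_zero.2 (pow_ne_zero 2 hx0)
  have hx2 : W.ordAt 0 (-(W.genX ^ 2)) = -4 := by
    rw [ordAt_neg, pow_two, ordAt_mul 0 hx0 hx0, ordAt_zero_genX]; norm_num
  -- `v_O(y - m₁ x - m₀) = -3`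
  set w : W.geomFunctionField := W.genY +
    (algebraMap _ W.geomFunctionField (-m₁) * W.genX + algebraMap _ W.geomFunctionField (-m₀))
    with hw
  have hw3 : w ≠ 0 ∧ W.ordAt 0 w = -3 := by
    by_cases h0 : algebraMap _ W.geomFunctionField (-m₁) * W.genX +
        algebraMap _ W.geomFunctionField (-m₀) = 0
    · rw [hw, h0, add_zero]; exact ⟨hy0, ord_zero_yF⟩
    · have h2 : -2 ≤ W.ordAt 0 (algebraMap _ W.geomFunctionField (-m₁) * W.genX +
          algebraMap _ W.geomFunctionField (-m₀)) := by
        rcases ordAt_zero_lin (W := W) (-m₁) (-m₀) with h | h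
        · exact absurd h h0
        · exact h
      have hlt : (W.place 0).ord W.genY < (W.place 0).ord (algebraMap _ W.geomFunctionField (-m₁) *
          W.genX + algebraMap _ W.geomFunctionField (-m₀)) := by
        rw [← ordAt_eq_ord_place 0 hy0, ← ordAt_eq_ord_place 0 h0, ord_zero_yF]; omega
      have h := (W.place 0).ord_add_eq_left_of_lt hy0 h0 hlt
      refine ⟨h.1, ?_⟩
      rw [ordAt_eq_ord_place 0 h.1, h.2, ← ordAt_eq_ord_place 0 hy0, ord_zero_yF]
  have hu : W.genY - aeval W.genX (X ^ 2 + C m₁ * X + C m₀) = -(W.genX ^ 2) + w := by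
    rw [hw]
    simp only [map_add, map_mul, map_pow, map_neg, aeval_X, aeval_C]
    ring
  have hlt : (W.place 0).ord (-(W.genX ^ 2)) < (W.place 0).ord w := by
    rw [← ordAt_eq_ord_place 0 hx2ne, ← ordAt_eq_ord_place 0 hw3.1, hx2, hw3.2]; norm_num
  have h := (W.place 0).ord_add_eq_left_of_lt hx2ne hw3.1 hlt
  rw [hu, ordAt_eq_ord_place 0 h.1, h.2, ← ordAt_eq_ord_place 0 hx2ne, hx2]

/-! ### The fibres of `u` and `u + 27/64` on the model -/

/-- On the model, the affine zeros of `u = y - (x² + x/2 + 9/32)` are the single point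
`(0, 9/32)`, and those of `u + 27/64` are the two points over `x = 9/8` and `x = -3/8`.
[cite: Zapponi2009BelyiDegree, §2.4] -/
theorem zeros_of_model (h₁ : W.a₁ = 0) (h₂ : W.a₂ = 13 / 16) (h₃ : W.a₃ = 0) (h₄ : W.a₄ = 9 / 32)
    (h₆ : W.a₆ = 81 / 1024) {α β : AlgebraicClosure K}
    (h : (W.baseChange (AlgebraicClosure K)).toAffine.Nonsingular α β) :
    (0 < W.ordAt (.some α β h) (W.genY - aeval W.genX
        (X ^ 2 + C (1 / 2 : AlgebraicClosure K) * X + C (9 / 32))) → α = 0 ∧ β = 9 / 32) ∧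
    (0 < W.ordAt (.some α β h) (W.genY - aeval W.genX
        (X ^ 2 + C (1 / 2 : AlgebraicClosure K) * X + C (9 / 32 - 27 / 64))) →
      (α = 9 / 8 ∨ α = -3 / 8) ∧
        β = (X ^ 2 + C (1 / 2 : AlgebraicClosure K) * X + C (9 / 32 - 27 / 64)).eval α) := by
  obtain ⟨n0, n1⟩ := norm_identities (k := AlgebraicClosure K) α
  constructor
  · intro hpos
    obtain ⟨hβ, hN⟩ := value_of_zero h₁ h₂ h₃ h₄ h₆ _ h hpos
    have hL : (X ^ 2 + C (1 / 2 : AlgebraicClosure K) * X + C (9 / 32)).eval α =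
        α ^ 2 + 1 / 2 * α + 9 / 32 := by
      simp only [eval_add, eval_mul, eval_pow, eval_X, eval_C]
    rw [hL, n0] at hN
    have hα : α = 0 := pow_eq_zero_iff (n := 4) (by norm_num) |>.1 hN
    subst hα
    refine ⟨rfl, ?_⟩
    rw [hβ, hL]; norm_num
  · intro hpos
    obtain ⟨hβ, hN⟩ := value_of_zero h₁ h₂ h₃ h₄ h₆ _ h hpos
    have hL : (X ^ 2 + C (1 / 2 : AlgebraicClosure K) * X + C (9 / 32 - 27 / 64)).eval α =
        α ^ 2 + 1 / 2 * α + (9 / 32 - 27 / 64) := by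
      simp only [eval_add, eval_mul, eval_pow, eval_X, eval_C]
    rw [hL, n1, mul_eq_zero] at hN
    refine ⟨?_, hβ⟩
    rcases hN with hN | hN
    · left; linear_combination hN
    · right; linear_combination pow_eq_zero_iff (n := 3) (by norm_num) |>.1 hN

/-- **`deg_B = 4` for the model `y² = x³ + (13/16)x² + (9/32)x + 81/1024` (`j = 207646/6561`)**:
the function `f = -(64/27)(y - x² - x/2 - 9/32)` has one place over `0`, two over `1`, one over
`∞` and degree `4 = #U₀ + #U₁ + #U_∞ - 2 + 2g`, hence is a Belyi function of degree `4`
(`IsBelyiFunction.of_card_eq`), and `deg_B ≠ 3` as `j ≠ 0`. [cite: Zapponi2009BelyiDegree, §2.4 and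
Example 1.2] -/
theorem belyiDegree_model (h₁ : W.a₁ = 0) (h₂ : W.a₂ = 13 / 16) (h₃ : W.a₃ = 0) (h₄ : W.a₄ = 9 / 32)
    (h₆ : W.a₆ = 81 / 1024) : belyiDegree (AlgebraicClosure K) W.geomFunctionField = 4 := by
  classical
  haveI : CharZero (AlgebraicClosure K) :=
    charZero_of_injective_algebraMap (algebraMap K (AlgebraicClosure K)).injective
  haveI := isIntegrallyClosedIn_of_isAlgClosed (K := AlgebraicClosure K) (F := W.geomFunctionField)
  haveI : (W.baseChange (AlgebraicClosure K)).IsElliptic := by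
    rw [WeierstrassCurve.baseChange]; infer_instance
  have hrat : ∀ P : PlaceOver (AlgebraicClosure K) W.geomFunctionField, P.IsRational :=
    PlaceOver.isRational_of_isAlgClosed
  obtain ⟨b₁, b₂, b₃, b₄, b₆⟩ := baseChange_coeffs (W := W) h₁ h₂ h₃ h₄ h₆
  haveI : CharZero W.geomFunctionField :=
    charZero_of_injective_algebraMap (algebraMap (AlgebraicClosure K) W.geomFunctionField).injective
  set Lq : (AlgebraicClosure K)[X] := X ^ 2 + C (1 / 2 : AlgebraicClosure K) * X + C (9 / 32)
    with hLq
  set u : W.geomFunctionField := W.genY - aeval W.genX Lq with hudef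
  set f : W.geomFunctionField := algebraMap (AlgebraicClosure K) W.geomFunctionField (-64 / 27) * u
    with hfdef
  have hu0 : W.ordAt 0 u = -4 := ordAt_zero_sub_quad _ _
  have hune : u ≠ 0 := by
    intro h0; rw [h0, ordAt_zero_right] at hu0; exact absurd hu0 (by norm_num)
  have hc : (-64 / 27 : AlgebraicClosure K) ≠ 0 := by norm_num
  have hordf : ∀ R : W.geomPoints, W.ordAt R f = W.ordAt R u := fun R ↦ by
    rw [hfdef, ordAt_algebraMap_mul R hc]
  have hf1 : f - 1 = algebraMap (AlgebraicClosure K) W.geomFunctionField (-64 / 27) *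
      (W.genY - aeval W.genX
        (X ^ 2 + C (1 / 2 : AlgebraicClosure K) * X + C (9 / 32 - 27 / 64))) := by
    rw [hfdef, hudef, hLq]
    simp only [map_add, map_sub, map_mul, map_pow, aeval_X, aeval_C, map_div₀, map_neg, map_ofNat,
      map_one]
    ring
  have hordf1 : ∀ R : W.geomPoints, W.ordAt R (f - 1) = W.ordAt R (W.genY - aeval W.genX
      (X ^ 2 + C (1 / 2 : AlgebraicClosure K) * X + C (9 / 32 - 27 / 64))) := fun R ↦ by
    rw [hf1, ordAt_algebraMap_mul R hc]
  have hune1 : W.genY - aeval W.genX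
      (X ^ 2 + C (1 / 2 : AlgebraicClosure K) * X + C (9 / 32 - 27 / 64)) ≠ 0 := by
    intro h0
    have := ordAt_zero_sub_quad (W := W) (1 / 2 : AlgebraicClosure K) (9 / 32 - 27 / 64)
    rw [h0, ordAt_zero_right] at this; exact absurd this (by norm_num)
  -- the special points
  have hP₀ : (W.baseChange (AlgebraicClosure K)).toAffine.Nonsingular 0 (9 / 32) := by
    refine (Affine.equation_iff_nonsingular).1 ?_
    rw [Affine.equation_iff, b₁, b₂, b₃, b₄, b₆]; norm_num
  have hpt : ∀ {α : AlgebraicClosure K}, (α = 9 / 8 ∨ α = -3 / 8) →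
      (W.baseChange (AlgebraicClosure K)).toAffine.Nonsingular α
        ((X ^ 2 + C (1 / 2 : AlgebraicClosure K) * X + C (9 / 32 - 27 / 64)).eval α) := by
    intro α hα
    refine (Affine.equation_iff_nonsingular).1 ?_
    rw [Affine.equation_iff, b₁, b₂, b₃, b₄, b₆]
    simp only [eval_add, eval_mul, eval_pow, eval_X, eval_C]
    rcases hα with rfl | rfl <;> norm_num
  set R₁ : W.geomPoints := .some _ _ (hpt (Or.inl rfl)) with hR₁
  set R₂ : W.geomPoints := .some _ _ (hpt (Or.inr rfl)) with hR₂
  set P₀ : W.geomPoints := .some _ _ hP₀ with hP₀def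
  have hR12 : R₁ ≠ R₂ := by
    intro heq
    have := (Affine.Point.some.inj heq).1
    norm_num at this
  -- zeros and poles, point-wise
  have hzero : ∀ R : W.geomPoints, 0 < W.ordAt R u ↔ R = P₀ := by
    intro R
    constructor
    · intro hpos
      have hR0 : R ≠ 0 := by rintro rfl; rw [hu0] at hpos; exact absurd hpos (by norm_num)
      obtain ⟨α, β, h, rfl⟩ := geomPoints.exists_eq_some hR0
      obtain ⟨hα, hβ⟩ := (zeros_of_model h₁ h₂ h₃ h₄ h₆ h).1 hpos
      subst hα; subst hβ; rfl
    · rintro rfl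
      exact ordAt_pos_of_value Lq hP₀ (by rw [hLq]; simp) hune
  have hone : ∀ R : W.geomPoints, 0 < W.ordAt R (W.genY - aeval W.genX
      (X ^ 2 + C (1 / 2 : AlgebraicClosure K) * X + C (9 / 32 - 27 / 64))) ↔ R = R₁ ∨ R = R₂ := by
    intro R
    constructor
    · intro hpos
      have hR0 : R ≠ 0 := by
        rintro rfl
        rw [ordAt_zero_sub_quad] at hpos; exact absurd hpos (by norm_num)
      obtain ⟨α, β, h, rfl⟩ := geomPoints.exists_eq_some hR0
      obtain ⟨hα, hβ⟩ := (zeros_of_model h₁ h₂ h₃ h₄ h₆ h).2 hpos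
      subst hβ
      rcases hα with rfl | rfl
      · exact Or.inl rfl
      · exact Or.inr rfl
    · rintro (rfl | rfl)
      · exact ordAt_pos_of_value _ _ rfl hune1
      · exact ordAt_pos_of_value _ _ rfl hune1
  have hpole : ∀ R : W.geomPoints, W.ordAt R u < 0 ↔ R = 0 := by
    intro R
    constructor
    · intro hneg
      by_contra hR0
      have := ordAt_sub_aeval_nonneg (W := W) Lq hR0
      rw [← hudef] at this
      omega
    · rintro rfl; rw [hu0]; norm_num
  -- the three fibres as sets of places
  have hfK : f ∉ Set.range (algebraMap (AlgebraicClosure K) W.geomFunctionField) := by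
    rintro ⟨c, hc'⟩
    have h0 : W.ordAt 0 f = 0 := by rw [← hc', ordAt_algebraMap]
    rw [hordf, hu0] at h0; exact absurd h0 (by norm_num)
  have hf0 : f ≠ 0 := fun h0 ↦ hfK ⟨0, by rw [map_zero, h0]⟩
  have hf1ne : f - 1 ≠ 0 := fun h0 ↦ hfK ⟨1, by rw [map_one]; exact (sub_eq_zero.1 h0).symm⟩
  set U₀ : Finset (PlaceOver (AlgebraicClosure K) W.geomFunctionField) :=
    (finite_setOf_ord_ne_zero_holds (K := AlgebraicClosure K) hf0).toFinset.filter
      fun P ↦ 0 < P.ord f with hU₀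
  set U₁ : Finset (PlaceOver (AlgebraicClosure K) W.geomFunctionField) :=
    (finite_setOf_ord_ne_zero_holds (K := AlgebraicClosure K) hf1ne).toFinset.filter
      fun P ↦ 0 < P.ord (f - 1) with hU₁
  set Ui : Finset (PlaceOver (AlgebraicClosure K) W.geomFunctionField) :=
    (finite_setOf_ord_ne_zero_holds (K := AlgebraicClosure K) hf0).toFinset.filter
      fun P ↦ P.ord f < 0 with hUi
  have hm₀ : ∀ P, P ∈ U₀ ↔ 0 < P.ord f := fun P ↦ by
    rw [hU₀, Finset.mem_filter, Set.Finite.mem_toFinset, Set.mem_setOf_eq]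
    exact ⟨fun h ↦ h.2, fun h ↦ ⟨h.ne', h⟩⟩
  have hm₁ : ∀ P, P ∈ U₁ ↔ 0 < P.ord (f - 1) := fun P ↦ by
    rw [hU₁, Finset.mem_filter, Set.Finite.mem_toFinset, Set.mem_setOf_eq]
    exact ⟨fun h ↦ h.2, fun h ↦ ⟨h.ne', h⟩⟩
  have hmi : ∀ P, P ∈ Ui ↔ P.ord f < 0 := fun P ↦ by
    rw [hUi, Finset.mem_filter, Set.Finite.mem_toFinset, Set.mem_setOf_eq]
    exact ⟨fun h ↦ h.2, fun h ↦ ⟨h.ne, h⟩⟩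
  have hU₀eq : U₀ = {W.place P₀} := by
    ext Q
    obtain ⟨R, rfl⟩ := place_surjective (W := W) Q
    rw [hm₀, Finset.mem_singleton, ← ordAt_eq_ord_place R hf0, hordf, hzero,
      place_injective.eq_iff]
  have hU₁eq : U₁ = {W.place R₁, W.place R₂} := by
    ext Q
    obtain ⟨R, rfl⟩ := place_surjective (W := W) Q
    rw [hm₁, Finset.mem_insert, Finset.mem_singleton, ← ordAt_eq_ord_place R hf1ne, hordf1, hone,
      place_injective.eq_iff, place_injective.eq_iff]
  have hUieq : Ui = {W.place 0} := by
    ext Q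
    obtain ⟨R, rfl⟩ := place_surjective (W := W) Q
    rw [hmi, Finset.mem_singleton, ← ordAt_eq_ord_place R hf0, hordf, hpole, place_injective.eq_iff]
  have hc₀ : U₀.card = 1 := by rw [hU₀eq, Finset.card_singleton]
  have hc₁ : U₁.card = 2 := by
    rw [hU₁eq, Finset.card_pair (fun h ↦ hR12 (place_injective h))]
  have hci : Ui.card = 1 := by rw [hUieq, Finset.card_singleton]
  -- the degree `[F : K(f)] = 4` from the pole
  have hdeg : Module.finrank (AlgebraicClosure K)⟮f⟯ W.geomFunctionField = 4 := by
    have h := sum_neg_ord_eq_finrank hrat hfK Ui (fun P hP ↦ (hmi P).1 hP) (fun P hP ↦ (hmi P).2 hP)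
    rw [hUieq, Finset.sum_singleton, ← ordAt_eq_ord_place 0 hf0, hordf, hu0] at h
    norm_num at h
    exact_mod_cast h.symm
  have hgen : genus (AlgebraicClosure K) W.geomFunctionField = 1 :=
    genus_functionField_weierstrass_holds _ (W.baseChange (AlgebraicClosure K)).toAffine
  have hf : IsBelyiFunction (AlgebraicClosure K) f :=
    IsBelyiFunction.of_card_eq hrat hfK U₀ U₁ Ui hm₀ hm₁ hmi
      (by rw [hc₀, hc₁, hci, hdeg, hgen]; norm_num)
  -- `deg_B = 4`
  have hle : belyiDegree (AlgebraicClosure K) W.geomFunctionField ≤ 4 := by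
    have := belyiDegree_le_finrank hf; rwa [hdeg] at this
  have hge : 3 ≤ belyiDegree (AlgebraicClosure K) W.geomFunctionField :=
    three_le_belyiDegree (W.baseChange (AlgebraicClosure K)).toAffine ⟨f, hf⟩
  have hj : W.j ≠ 0 := by
    rw [Ne, WeierstrassCurve.j_eq_zero_iff, WeierstrassCurve.c₄, WeierstrassCurve.b₂,
      WeierstrassCurve.b₄, h₁, h₂, h₃, h₄]
    norm_num
  have hne3 := belyiDegree_ne_three_of_j_ne_zero W hj
  omega

/-- `j = 207646/6561` for the model. [cite: Zapponi2009BelyiDegree, §2.4] -/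
theorem j_model (h₁ : W.a₁ = 0) (h₂ : W.a₂ = 13 / 16) (h₃ : W.a₃ = 0) (h₄ : W.a₄ = 9 / 32)
    (h₆ : W.a₆ = 81 / 1024) : W.j = 207646 / 6561 := by
  have hK : 6561 * W.c₄ ^ 3 = 207646 * W.Δ := by
    simp only [WeierstrassCurve.c₄, WeierstrassCurve.Δ, WeierstrassCurve.b₂, WeierstrassCurve.b₄,
      WeierstrassCurve.b₆, WeierstrassCurve.b₈, h₁, h₂, h₃, h₄, h₆]
    norm_num
  have hΔ : (W.Δ'⁻¹ : Kˣ) * W.Δ = 1 := by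
    rw [← WeierstrassCurve.coe_Δ', Units.inv_mul]
  rw [WeierstrassCurve.j]
  linear_combination (↑W.Δ'⁻¹ / 6561 : K) * hK + (207646 / 6561 : K) * hΔ

end BelyiDegreeFourConverse

open BelyiDegreeFourConverse

/-! ### The classification of the curves of Belyi degree `4` -/

section Main

variable {K : Type u} [Field K] [CharZero K] (W : WeierstrassCurve K) [W.IsElliptic]

/-- **`j(E) = 207646/6561 ⇒ deg_B(E) = 4`** (any model; through the model
`y² = x³ + (13/16)x² + (9/32)x + 81/1024` and `belyiDegree_eq_of_j_eq`).
[cite: Zapponi2009BelyiDegree, Example 1.2] -/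
theorem belyiDegree_eq_four_of_j_eq (hj : W.j = 207646 / 6561) :
    belyiDegree (AlgebraicClosure K) W.geomFunctionField = 4 := by
  let E₁ : WeierstrassCurve K := ⟨0, 13 / 16, 0, 9 / 32, 81 / 1024⟩
  haveI hE : E₁.IsElliptic := ⟨by
    rw [isUnit_iff_ne_zero]
    simp only [WeierstrassCurve.Δ, WeierstrassCurve.b₂, WeierstrassCurve.b₄, WeierstrassCurve.b₆,
      WeierstrassCurve.b₈, E₁]
    norm_num⟩
  have hj₁ : E₁.j = 207646 / 6561 := j_model (W := E₁) rfl rfl rfl rfl rfl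
  rw [belyiDegree_eq_of_j_eq W E₁ (hj.trans hj₁.symm)]
  exact belyiDegree_model (W := E₁) rfl rfl rfl rfl rfl

/-- **Zapponi's classification of the elliptic curves of Belyi degree `4`: `deg_B(E) = 4 ↔
j(E) ∈ {1728, 207646/6561}`** (`E/K`, `char K = 0`, Belyi degree of `K̄(E)`).
[cite: Zapponi2009BelyiDegree, Example 1.2] -/
theorem belyiDegree_eq_four_iff :
    belyiDegree (AlgebraicClosure K) W.geomFunctionField = 4 ↔
      W.j = 1728 ∨ W.j = 207646 / 6561 := by
  refine ⟨j_eq_of_belyiDegree_eq_four W, ?_⟩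
  rintro (h | h)
  · exact belyiDegree_eq_four_of_j_eq_1728 W h
  · exact belyiDegree_eq_four_of_j_eq W h

/-- The same for the quantity `deg_B(E_Ω)` of the named fact, any algebraic closure `Ω`.
[cite: Zapponi2009BelyiDegree, Example 1.2] -/
theorem belyiDegree_baseChange_eq_four_iff (K : Type) [Field K] [CharZero K]
    (W : WeierstrassCurve K) [W.IsElliptic] (Ω : Type) [Field Ω] [Algebra K Ω] [IsAlgClosure K Ω] :
    belyiDegree Ω (W.baseChange Ω).toAffine.FunctionField = 4 ↔
      W.j = 1728 ∨ W.j = 207646 / 6561 := by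
  rw [belyiDegree_baseChange_eq_geom K W Ω]
  exact belyiDegree_eq_four_iff W

/-- **The Belyi degrees `≤ 4` of elliptic curves over a number field** (Zapponi's Example 1.2 in the
setting of `javanpeykar2014_stableFaltingsHeight_le`): `deg_B(E_Ω) = 3 ↔ j = 0`,
`deg_B(E_Ω) = 4 ↔ j ∈ {1728, 207646/6561}`, and `deg_B(E_Ω) ≥ 5` otherwise.
[cite: Zapponi2009BelyiDegree, Example 1.2] -/
theorem belyiDegree_baseChange_classification (K : Type) [Field K] [NumberField K]
    (W : WeierstrassCurve K) [W.IsElliptic] (Ω : Type) [Field Ω] [Algebra K Ω] [IsAlgClosure K Ω] :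
    (belyiDegree Ω (W.baseChange Ω).toAffine.FunctionField = 3 ↔ W.j = 0) ∧
    (belyiDegree Ω (W.baseChange Ω).toAffine.FunctionField = 4 ↔
      W.j = 1728 ∨ W.j = 207646 / 6561) ∧
    (5 ≤ belyiDegree Ω (W.baseChange Ω).toAffine.FunctionField ↔
      W.j ≠ 0 ∧ W.j ≠ 1728 ∧ W.j ≠ 207646 / 6561) := by
  refine ⟨belyiDegree_baseChange_eq_three_iff_j_eq_zero K W Ω,
    belyiDegree_baseChange_eq_four_iff K W Ω,
    ⟨fun h5 ↦ ?_, fun h ↦ five_le_belyiDegree_baseChange K W Ω h.1 h.2.1 h.2.2⟩⟩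
  refine ⟨fun hj ↦ ?_, fun hj ↦ ?_, fun hj ↦ ?_⟩
  · have := (belyiDegree_baseChange_eq_three_iff_j_eq_zero K W Ω).2 hj; omega
  · have := (belyiDegree_baseChange_eq_four_iff K W Ω).2 (Or.inl hj); omega
  · have := (belyiDegree_baseChange_eq_four_iff K W Ω).2 (Or.inr hj); omega

/-! ### Javanpeykar's inequality in Belyi degree `≤ 4` (appended) -/

/-- **`javanpeykar2014_stableFaltingsHeight_le` holds for every elliptic curve of Belyi degree `3`**
(over any number field, any algebraic closure `Ω`): `deg_B(E_Ω) = 3 ⇒ j(E) = 0`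
(`belyiDegree_baseChange_eq_three_iff_j_eq_zero`) and `h_F(E) ≤ 3` for `j = 0`
(`FaltingsHeightJZero`). [cite: Javanpeykar2014, Thm. 1.1.1] -/
theorem javanpeykar2014_stableFaltingsHeight_le_of_belyiDegree_eq_three (K : Type) [Field K]
    [NumberField K] (W : WeierstrassCurve K) [W.IsElliptic] (Ω : Type) [Field Ω] [Algebra K Ω]
    [IsAlgClosure K Ω] (h3 : belyiDegree Ω (W.baseChange Ω).toAffine.FunctionField = 3)
    (f : (W.baseChange Ω).toAffine.FunctionField) (hf : IsBelyiFunction Ω f) :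
    W.stableFaltingsHeight ≤
      13 * 10 ^ 6 * (Module.finrank Ω⟮f⟯ (W.baseChange Ω).toAffine.FunctionField : ℝ) ^ 5 :=
  javanpeykar2014_stableFaltingsHeight_le_of_j_eq_zero K W
    ((belyiDegree_baseChange_eq_three_iff_j_eq_zero K W Ω).1 h3) Ω f hf

/-- **`javanpeykar2014_stableFaltingsHeight_le` holds for every elliptic curve with
`j = 207646/6561`** (`h_F(E) ≤ 1` by the explicit form of Silverman's lower inequality,
`stableFaltingsHeight_le_one_of_j_eq`; these are the non-CM curves of Belyi degree `4`).
[cite: Javanpeykar2014, Thm. 1.1.1] -/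
theorem javanpeykar2014_stableFaltingsHeight_le_of_j_eq_207646_div_6561 (K : Type) [Field K]
    [NumberField K] (W : WeierstrassCurve K) [W.IsElliptic] (hj : W.j = 207646 / 6561)
    (Ω : Type) [Field Ω] [Algebra K Ω] [IsAlgClosure K Ω]
    (f : (W.baseChange Ω).toAffine.FunctionField) (hf : IsBelyiFunction Ω f) :
    W.stableFaltingsHeight ≤
      13 * 10 ^ 6 * (Module.finrank Ω⟮f⟯ (W.baseChange Ω).toAffine.FunctionField : ℝ) ^ 5 := by
  have h1 := stableFaltingsHeight_le_one_of_j_eq W hj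
  have hd : (1 : ℝ) ≤ Module.finrank Ω⟮f⟯ (W.baseChange Ω).toAffine.FunctionField := by
    have h3 := three_le_belyiDegree_baseChange K W Ω
    have h2 := belyiDegree_le_finrank hf
    exact_mod_cast (show 1 ≤ Module.finrank Ω⟮f⟯ (W.baseChange Ω).toAffine.FunctionField by omega)
  have hd5 : (1 : ℝ) ≤ (Module.finrank Ω⟮f⟯ (W.baseChange Ω).toAffine.FunctionField : ℝ) ^ 5 :=
    one_le_pow₀ hd
  nlinarith

/-- **`javanpeykar2014_stableFaltingsHeight_le` HOLDS FOR EVERY ELLIPTIC CURVE OF BELYI DEGREE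
`≤ 4`** (any number field `K`, any algebraic closure `Ω`): the curves with `deg_B(E_Ω) ≤ 4` have
`j ∈ {0, 1728, 207646/6561}` (`j_mem_of_belyiDegree_baseChange_le_four`, Zapponi's list), and for
these `h_F(E) ≤ 3` (`FaltingsHeightJZero`: Chowla–Selberg for `j = 0, 1728`;
`FaltingsHeightJInvariantExplicit`: explicit Silverman for `j = 207646/6561`), while the
right-hand side is `≥ 13·10⁶`. [cite: Javanpeykar2014, Thm. 1.1.1] -/
theorem javanpeykar2014_stableFaltingsHeight_le_of_belyiDegree_le_four (K : Type) [Field K]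
    [NumberField K] (W : WeierstrassCurve K) [W.IsElliptic] (Ω : Type) [Field Ω] [Algebra K Ω]
    [IsAlgClosure K Ω] (h4 : belyiDegree Ω (W.baseChange Ω).toAffine.FunctionField ≤ 4)
    (f : (W.baseChange Ω).toAffine.FunctionField) (hf : IsBelyiFunction Ω f) :
    W.stableFaltingsHeight ≤
      13 * 10 ^ 6 * (Module.finrank Ω⟮f⟯ (W.baseChange Ω).toAffine.FunctionField : ℝ) ^ 5 := by
  rcases j_mem_of_belyiDegree_baseChange_le_four K W Ω h4 with h | h | h
  · exact javanpeykar2014_stableFaltingsHeight_le_of_j_eq_zero K W h Ω f hf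
  · exact javanpeykar2014_stableFaltingsHeight_le_of_j_eq_1728 K W h Ω f hf
  · exact javanpeykar2014_stableFaltingsHeight_le_of_j_eq_207646_div_6561 K W h Ω f hf

/-- **`javanpeykar2014_stableFaltingsHeight_le` holds for every elliptic curve whose
`j`-invariant has height `≤ 3.79·10¹⁰`**: by the explicit Silverman inequality
(`stableFaltingsHeight_le_explicit`) `h_F(E) ≤ (h(j) − 9)/12` with
`h(j) = [K:ℚ]⁻¹(log N(𝔇_j) + Σ_σ log max(|σ j|, 1))`, while the right-hand side of the fact is
`≥ 13·10⁶ · 3⁵` (`deg_B ≥ 3`). So Javanpeykar's theorem is needed only for curves of enormous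
`j`-height. [cite: Javanpeykar2014, Thm. 1.1.1] [cite: Silverman1986, Prop. 2.1] -/
theorem javanpeykar2014_stableFaltingsHeight_le_of_jHeight_le (K : Type) [Field K]
    [NumberField K] (W : WeierstrassCurve K) [W.IsElliptic]
    (hH : (Module.finrank ℚ K : ℝ)⁻¹ * Real.log (Ideal.absNorm W.jDenominatorIdeal) +
        (Module.finrank ℚ K : ℝ)⁻¹ * ∑ σ : K →+* ℂ, Real.log (max ‖σ W.j‖ 1) ≤
      379 * 10 ^ 8)
    (Ω : Type) [Field Ω] [Algebra K Ω] [IsAlgClosure K Ω]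
    (f : (W.baseChange Ω).toAffine.FunctionField) (hf : IsBelyiFunction Ω f) :
    W.stableFaltingsHeight ≤
      13 * 10 ^ 6 * (Module.finrank Ω⟮f⟯ (W.baseChange Ω).toAffine.FunctionField : ℝ) ^ 5 := by
  have h := stableFaltingsHeight_le_explicit W
  have hd : (3 : ℝ) ≤ Module.finrank Ω⟮f⟯ (W.baseChange Ω).toAffine.FunctionField := by
    have h3 := three_le_belyiDegree_baseChange K W Ω
    have h2 := belyiDegree_le_finrank hf
    exact_mod_cast h3.trans h2
  have hd5 : (3 : ℝ) ^ 5 ≤ (Module.finrank Ω⟮f⟯ (W.baseChange Ω).toAffine.FunctionField : ℝ) ^ 5 :=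
    pow_le_pow_left₀ (by norm_num) hd 5
  nlinarith

open Height in
/-- The same with Mathlib's Weil height: **`javanpeykar2014_stableFaltingsHeight_le` holds for every
elliptic curve with `[K:ℚ]⁻¹ log H_K(j_E) ≤ 3.79·10¹⁰`** (`logHeight₁_j_eq_sum_embeddings`).
[cite: Javanpeykar2014, Thm. 1.1.1] [cite: Silverman1986, Prop. 2.1] -/
theorem javanpeykar2014_stableFaltingsHeight_le_of_logHeight₁_j_le (K : Type) [Field K]
    [NumberField K] (W : WeierstrassCurve K) [W.IsElliptic]
    (hH : (Module.finrank ℚ K : ℝ)⁻¹ * logHeight₁ W.j ≤ 379 * 10 ^ 8)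
    (Ω : Type) [Field Ω] [Algebra K Ω] [IsAlgClosure K Ω]
    (f : (W.baseChange Ω).toAffine.FunctionField) (hf : IsBelyiFunction Ω f) :
    W.stableFaltingsHeight ≤
      13 * 10 ^ 6 * (Module.finrank Ω⟮f⟯ (W.baseChange Ω).toAffine.FunctionField : ℝ) ^ 5 := by
  rw [logHeight₁_j_eq_sum_embeddings, mul_add] at hH
  exact javanpeykar2014_stableFaltingsHeight_le_of_jHeight_le K W hH Ω f hf

end Main



end Literature.NumberTheory.DiophantineGeometry

end
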